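import Summits.ResolutionOfSingularities.ResolutionOfSingularities.Theorems.HomologicalConductorNoZenoGaloisAscent
import Summits.ResolutionOfSingularities.ResolutionOfSingularities.Theorems.HomologicalConductorNoZenoGaloisSymmetryDischarge
import Summits.ResolutionOfSingularities.ResolutionOfSingularities.Theorems.HomologicalConductorNoZenoUnramifiedDischarge
import Summits.ResolutionOfSingularities.ResolutionOfSingularities.Theorems.HomologicalConductorNoZenoMinimalityDescent
import Literature.AlgebraicGeometry.Resolution.RationalSurfaceSingularitiesBasic
import Literature.AlgebraicGeometry.Resolution.Lipman1969FormallySmoothBaseChange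
import Literature.AlgebraicGeometry.Resolution.ProjectiveSpaceRegular
import Literature.AlgebraicGeometry.Resolution.AdicCompletionRegular
import HarnessLib

/-!
# Crux `NoZenoR` (stmt-ResolutionOfSingularities-19943), β layer, `stub_L1wCoreF` descent brick: **BC-4 ASSEMBLED**
# — the minimal desingularization stays minimal after base change to the splitting germ

Route `ResolutionOfSingularities/HomologicalConductor`, crux chain W4.4.  OURS (cell res-hironaka, seat res-L0-w44-stub-2,
(L1)-PREP v4 §2 / planner (ρ43)/(ρ48)); AI-written, weaker than expert review; nothing here is a statement of the
manuscript under review (Hironaka 2017).  Def-free, `--supports 19943 --as helper`.  CONDITIONAL on the route's declared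
Literature named facts (Lipman 1969 (16.1)(ii), (16.5), (27.3), (13.1) b), d), (4.1) — binders `h161 h165 h273 h131b h131d
h41`, all in `Sig.FactsW3`).

**BC-4** («minimality of the desingularization ascends along the splitting base change», PREP v4 §1–2): for a
two-dimensional normal local domain `S` with a rational singularity, `π : X → Spec S` its MINIMAL desingularization, and
res-D-pv-039's Galois splitting germ `S → Ŝ` (`…SplitGaloisPackage.exists_galoisGerm₂`: flat, local, `𝔪_S Ŝ = 𝔪_Ŝ`,
`κ(Ŝ)/κ(S)` finite Galois with every `κ(S)`-automorphism induced by an `S`-automorphism of `Ŝ`, `Ŝ` a localisation of a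
formally unramified finite-type `S`-algebra `B`):

* **`isMinimalResolution_pullback_snd_of_galois`** — `X ×_S Spec Ŝ → Spec Ŝ` is the MINIMAL desingularization of `Ŝ`:
  Galois ASCENT `…NoZenoGaloisAscent.isMinimalResolution_of_flat_of_symmetric` with its two hypotheses discharged by
  `…NoZenoUnramifiedDischarge` (U) and `…NoZenoGaloisSymmetryDischarge` (T); the regular case separately
  (`π` is then an isomorphism);
* **`isMinimalResolution_pullback_snd_of_tower`** — for an intermediate germ `S → S_f → Ŝ` (`S_f` flat, local,
  unramified with separable residue extension over `S`, and `Ŝ` the same over `S_f`: the D2′ one-root germ),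
  `X ×_S Spec S_f → Spec S_f` is the MINIMAL desingularization of `S_f`: fpqc DESCENT of minimality
  (`…NoZenoMinimalityDescent.isMinimalResolution_of_baseChange`) from `Ŝ` along the faithfully flat `Spec Ŝ → Spec S_f`.

References: J. Lipman, *Rational singularities…*, Publ. Math. IHÉS 36 (1969), Thm. (4.1) p. 204, Prop. (13.1) p. 223,
Lemma (16.1) p. 231, Prop. (16.5) p. 235, (27.3) p. 277 [`Lipman1969`]; B. Conrad–B. Edixhoven–W. Stein, Doc. Math. 8
(2003) Thm. 2.2.2 (the residually-trivial case, context) [folklore]; A. Grothendieck, SGA 1 VIII (fpqc descent) [folklore].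
-/

noncomputable section

-- single-problem summit: the doubled namespace component `ResolutionOfSingularities` is forced
set_option linter.dupNamespace false

namespace Summit.ResolutionOfSingularities.ResolutionOfSingularities.Theorems.NoZeno.ExcCount

open CategoryTheory AlgebraicGeometry Limits IsLocalRing
open Literature.AlgebraicGeometry.Resolution

universe u

section Galois

variable {S Ŝ B : Type u} [CommRing S] [IsNoetherianRing S] [IsLocalRing S] [IsDomain S] [IsIntegrallyClosed S]
  [CommRing Ŝ] [IsNoetherianRing Ŝ] [IsLocalRing Ŝ] [Algebra S Ŝ] [IsLocalHom (algebraMap S Ŝ)] [Module.Flat S Ŝ]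
  [CommRing B] [Algebra S B] [Algebra B Ŝ] [IsScalarTower S B Ŝ]
  [FiniteDimensional (ResidueField S) (ResidueField Ŝ)] [IsGalois (ResidueField S) (ResidueField Ŝ)]
  {X : Scheme.{u}} (π : X ⟶ Spec (.of S))

/-- **BC-4b (Galois ascent, assembled).**  Let `S` be a two-dimensional normal Noetherian local domain with a rational
singularity and `π : X → Spec S` its minimal desingularization; let `S → Ŝ` be flat and local with `𝔪_S Ŝ = 𝔪_Ŝ`,
`dim Ŝ = 2`, `κ(Ŝ)/κ(S)` finite Galois with every `κ(S)`-automorphism of `κ(Ŝ)` induced by some `S`-automorphism `ρ h`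
of `Ŝ`, and `Ŝ` a localisation of a formally unramified finite-type `S`-algebra `B`.  Then `X ×_S Spec Ŝ → Spec Ŝ` is
the MINIMAL desingularization of `Spec Ŝ`.  (Conditional on Lipman (16.1)(ii), (16.5), (27.3), (13.1) b), d).)
[this work; cite: Lipman1969, Lemma (16.1) (p. 231), Proposition (16.5) (p. 235), (27.3) (p. 277)] -/
theorem isMinimalResolution_pullback_snd_of_galois (M : Submonoid B) [IsLocalization M Ŝ]
    [Algebra.FormallyUnramified S B] [Algebra.FiniteType S B]
    {H : Type*} [Group H] (ρ : H →* (Ŝ ≃ₐ[S] Ŝ))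
    (hres : ∀ σ' : ResidueField Ŝ ≃ₐ[ResidueField S] ResidueField Ŝ, ∃ h : H, ∀ s : Ŝ,
      residue Ŝ (ρ h s) = σ' (residue Ŝ s))
    (h161 : Lipman1969_16_1_ii.{u}) (h165 : Lipman1969_16_5.{u}) (h273 : Lipman1969_27_3_rat.{u})
    (h131b : Lipman1969_13_1_b_rat.{u}) (h131d : Lipman1969_13_1_d_rat.{u})
    (h2 : ringKrullDim S = 2) (h2B : ringKrullDim Ŝ = 2) (hS : HasRationalSingularity S)
    (hmax : (maximalIdeal S).map (algebraMap S Ŝ) = maximalIdeal Ŝ) (hπ : IsMinimalResolution π)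
    (ι : Spec (.of Ŝ) ⟶ Spec (.of S)) (hι : ι = Spec.map (CommRingCat.ofHom (algebraMap S Ŝ))) :
    IsMinimalResolution (pullback.snd π ι) := by
  subst hι
  haveI : Algebra.IsSeparable (ResidueField S) (ResidueField Ŝ) := IsGalois.to_isSeparable
  -- (16.1)(ii): the base change is a desingularization; (16.5): `Ŝ` is a normal domain with a rational singularity
  obtain ⟨-, hπB⟩ := h161 S Ŝ inferInstance hmax inferInstance X π hπ.1
  obtain ⟨hnorm, hrat⟩ := h165 S Ŝ inferInstance hmax inferInstance h2 h2B ⟨X, π, hπ.1⟩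
  obtain ⟨hdomB, hicB⟩ := hnorm.mp ⟨inferInstance, inferInstance⟩
  haveI := hdomB
  haveI := hicB
  have hSB : HasRationalSingularity Ŝ := (hrat ⟨inferInstance, inferInstance⟩).mp hS
  by_cases hreg : IsRegularLocalRing S
  · -- `S` regular: `π`, hence its base change, is an isomorphism, trivially minimal
    haveI := hreg
    haveI := isRegularRing_of_isRegularLocalRing S
    haveI : IsIso π :=
      hπ.isIso_of_comp_eq (isMinimalResolution_id (Scheme.isRegular_Spec (.of S))) π (Category.comp_id π)
    refine ⟨hπB, fun Y ρ' _ => ⟨ρ' ≫ inv (pullback.snd π (Spec.map (CommRingCat.ofHom (algebraMap S Ŝ)))), ?_⟩⟩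
    rw [Category.assoc, IsIso.inv_hom_id, Category.comp_id]
  · exact isMinimalResolution_of_flat_of_symmetric π (pullback.snd π _) (pullback.fst π _)
      (IsPullback.of_hasPullback _ _) h273 h131b h131d h2 h2B hS hSB hreg hmax hπ hπB
      (fun ζ _ => map_maximalIdeal_stalkMap_fst_eq π M ζ)
      (hsymm_of_residue_surjective π hmax ρ hres _ rfl)

end Galois

section Tower

variable {S Sf Ŝ B : Type u} [CommRing S] [IsNoetherianRing S] [IsLocalRing S] [IsDomain S] [IsIntegrallyClosed S]
  [CommRing Sf] [IsNoetherianRing Sf] [IsLocalRing Sf] [Algebra S Sf] [IsLocalHom (algebraMap S Sf)] [Module.Flat S Sf]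
  [Algebra.IsSeparable (ResidueField S) (ResidueField Sf)]
  [CommRing Ŝ] [IsNoetherianRing Ŝ] [IsLocalRing Ŝ] [Algebra S Ŝ] [IsLocalHom (algebraMap S Ŝ)] [Module.Flat S Ŝ]
  [Algebra Sf Ŝ] [IsScalarTower S Sf Ŝ] [IsLocalHom (algebraMap Sf Ŝ)] [Module.Flat Sf Ŝ]
  [Algebra.IsSeparable (ResidueField Sf) (ResidueField Ŝ)]
  [CommRing B] [Algebra S B] [Algebra B Ŝ] [IsScalarTower S B Ŝ]
  [FiniteDimensional (ResidueField S) (ResidueField Ŝ)] [IsGalois (ResidueField S) (ResidueField Ŝ)]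
  {X : Scheme.{u}} (π : X ⟶ Spec (.of S))

omit [IsNoetherianRing Sf] [IsNoetherianRing Ŝ] [Algebra.IsSeparable (ResidueField Sf) (ResidueField Ŝ)] in
/-- `Spec Ŝ → Spec S_f` is surjective for `S_f → Ŝ` flat and local (faithfully flat). [folklore] -/
theorem surjective_specMap_of_flat_of_isLocalHom :
    Surjective (Spec.map (CommRingCat.ofHom (algebraMap Sf Ŝ))) := by
  haveI : Module.FaithfullyFlat Sf Ŝ := Module.FaithfullyFlat.of_flat_of_isLocalHom
  exact ⟨PrimeSpectrum.comap_surjective_of_faithfullyFlat (A := Sf) (B := Ŝ)⟩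

/-- **BC-4 (PREP v4 §1) for the one-root germ, assembled: ascent to the Galois germ, then fpqc descent.**  With `S`,
`π`, `Ŝ`, `B`, `ρ` as in `isMinimalResolution_pullback_snd_of_galois`, and an intermediate local ring `S → S_f → Ŝ` with
`S → S_f` and `S_f → Ŝ` flat, local, unramified (`𝔪 S_f = 𝔪_{S_f}`, `𝔪_{S_f} Ŝ = 𝔪_Ŝ`) with separable residue
extensions and `dim S_f = 2` (res-D-pv-039's `exists_galoisGerm₂` over the D2′ germ): `X ×_S Spec S_f → Spec S_f` is
the MINIMAL desingularization of `Spec S_f`.  (Conditional on Lipman (4.1), (16.1)(ii), (16.5), (27.3), (13.1) b), d).)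
[this work; cite: Lipman1969, Theorem (4.1) (p. 204), Lemma (16.1) (p. 231), Proposition (16.5) (p. 235)] -/
theorem isMinimalResolution_pullback_snd_of_tower (M : Submonoid B) [IsLocalization M Ŝ]
    [Algebra.FormallyUnramified S B] [Algebra.FiniteType S B]
    {H : Type*} [Group H] (ρ : H →* (Ŝ ≃ₐ[S] Ŝ))
    (hres : ∀ σ' : ResidueField Ŝ ≃ₐ[ResidueField S] ResidueField Ŝ, ∃ h : H, ∀ s : Ŝ,
      residue Ŝ (ρ h s) = σ' (residue Ŝ s))
    (h41 : Lipman1969_4_1.{u}) (h161 : Lipman1969_16_1_ii.{u}) (h165 : Lipman1969_16_5.{u})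
    (h273 : Lipman1969_27_3_rat.{u}) (h131b : Lipman1969_13_1_b_rat.{u}) (h131d : Lipman1969_13_1_d_rat.{u})
    (h2 : ringKrullDim S = 2) (h2f : ringKrullDim Sf = 2) (h2B : ringKrullDim Ŝ = 2) (hS : HasRationalSingularity S)
    (hmf : (maximalIdeal S).map (algebraMap S Sf) = maximalIdeal Sf)
    (hmf' : (maximalIdeal Sf).map (algebraMap Sf Ŝ) = maximalIdeal Ŝ)
    (hmax : (maximalIdeal S).map (algebraMap S Ŝ) = maximalIdeal Ŝ) (hπ : IsMinimalResolution π)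
    (ιf : Spec (.of Sf) ⟶ Spec (.of S)) (hιf : ιf = Spec.map (CommRingCat.ofHom (algebraMap S Sf))) :
    IsMinimalResolution (pullback.snd π ιf) := by
  subst hιf
  -- `S_f` is a normal domain with a rational singularity ((16.5) along `S → S_f`); `π_f` is a desingularization
  obtain ⟨hnormf, hratf⟩ := h165 S Sf inferInstance hmf inferInstance h2 h2f ⟨X, π, hπ.1⟩
  obtain ⟨hdomf, hicf⟩ := hnormf.mp ⟨inferInstance, inferInstance⟩
  haveI := hdomf
  haveI := hicf
  have hSf : HasRationalSingularity Sf := (hratf ⟨inferInstance, inferInstance⟩).mp hS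
  obtain ⟨-, hπf⟩ := h161 S Sf inferInstance hmf inferInstance X π hπ.1
  -- the Galois germ over `S`: `Spec Ŝ → Spec S_f → Spec S`
  set g := Spec.map (CommRingCat.ofHom (algebraMap Sf Ŝ)) with hg
  set ιf := Spec.map (CommRingCat.ofHom (algebraMap S Sf)) with hιf
  have hι : g ≫ ιf = Spec.map (CommRingCat.ofHom (algebraMap S Ŝ)) :=
    (specMap_algebraMap_eq_comp (S := S) (B := Sf) (Ŝ := Ŝ)).symm
  have hminB : IsMinimalResolution (pullback.snd π (g ≫ ιf)) :=
    isMinimalResolution_pullback_snd_of_galois π M ρ hres h161 h165 h273 h131b h131d h2 h2B hS hmax hπ (g ≫ ιf) hι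
  -- the cartesian square `X ×_S Spec Ŝ → X ×_S Spec S_f` over `g`
  set σ' : pullback π (g ≫ ιf) ⟶ pullback π ιf :=
    pullback.lift (pullback.fst π (g ≫ ιf)) (pullback.snd π (g ≫ ιf) ≫ g)
      (by rw [Category.assoc]; exact pullback.condition) with hσ'
  have hσ1 : σ' ≫ pullback.fst π ιf = pullback.fst π (g ≫ ιf) := pullback.lift_fst _ _ _
  have hσ2 : σ' ≫ pullback.snd π ιf = pullback.snd π (g ≫ ιf) ≫ g := pullback.lift_snd _ _ _
  have Hsq : IsPullback σ' (pullback.snd π (g ≫ ιf)) (pullback.snd π ιf) g := by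
    refine IsPullback.of_right (h₁₁ := σ') (h₁₂ := pullback.fst π ιf) (h₂₁ := g) (h₂₂ := ιf)
      (v₁₁ := pullback.snd π (g ≫ ιf)) (v₁₂ := pullback.snd π ιf) (v₁₃ := π) ?_ hσ2 (IsPullback.of_hasPullback π ιf)
    rw [hσ1]
    exact IsPullback.of_hasPullback π (g ≫ ιf)
  -- `g` is surjective, flat and quasi-compact
  haveI : Surjective g := surjective_specMap_of_flat_of_isLocalHom
  haveI : Flat g := by
    rw [hg, HasRingHomProperty.Spec_iff (P := @Flat), CommRingCat.hom_ofHom, RingHom.flat_algebraMap_iff]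
    infer_instance
  -- fpqc descent of minimality
  exact isMinimalResolution_of_baseChange g Hsq hπf hminB
    (Lipman1969_4_1.exists_isMinimalResolution_Spec h41 Sf h2f hSf)
    (fun Y ρ' hρ' => (h161 Sf Ŝ inferInstance hmf' inferInstance Y ρ' hρ').2)

end Tower

end Summit.ResolutionOfSingularities.ResolutionOfSingularities.Theorems.NoZeno.ExcCount

end
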